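import Summits.Ventures.DiscreteObjects.PP12.LiftedPlaneZp

/-!
# PP(12): the live cell `|G| = 3` split into typed sub-cells, and the rigid endgame v3 (kernel)
Framing: lottery ticket; floor = certified bounds/negative ranges.

Cell pub-namedobj (venture DiscreteObjects), target (M), designs gen 9.  `OrderThree.order_three_structure` (p-typed) says a
collineation `σ ≠ 1`, `σ³ = 1` of a projective plane of order 12 is an ELATION, or PLANAR of order 3 (13 fixed points and lines,
4 fixed points on every fixed line and 4 fixed lines through every fixed point), or of FLAG TYPE (all fixed points on a fixed line
`l`, all fixed lines through a fixed point `c ∈ l`, `f, g ∈ {1, 4, 7, 10}`).  This file TYPES the three sub-cells as census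
statements — `NoElationOrder3Order12` (`LiftedPlaneZp`; a theorem in print, Janko–van Trung 1981; by
`noElationOrder3_iff_noLiftableSTD3` equivalent to the finite array statement `NoLiftableSTD3_12_4`), **`NoPlanarOrder3Order12`**,
**`NoFlagOrder3Order12`** (both NOT proved: the open structured sub-cells of NAMEDOBJ-TABLE §M, 'beyond bound k') — and proves
`noOrderThree_of_subcells : NoElationOrder3Order12 → NoPlanarOrder3Order12 → NoFlagOrder3Order12 → NoOrderThreeOrder12` and the
array form `noOrderThree_of_arrays`.  With `LiveCellsLift`: **`card_collineationGroup_eq_one_of_arrays`** — GIVEN Janko–van Trung's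
`{2,3}`-group theorem (named fact), the two finite array statements `NoLiftableSTD2_12_6`, `NoLiftableSTD3_12_4` and the two census
statements `NoPlanarOrder3Order12`, `NoFlagOrder3Order12`, every collineation group of a projective plane of order 12 is trivial.
Nothing else is assumed; no `sorry`.
-/

namespace Summit.Ventures.DiscreteObjects.PP12

open Configuration Finset Literature.Combinatorics.Designs Summit.Ventures.DiscreteObjects.STD
open scoped Classical

/-- **Census statement, sub-cell 'planar of order 3' (typed, NOT proved):** no projective plane of order 12 admits a
collineation `σ` with `σ³ = 1` fixing exactly 13 points and 13 lines, 4 fixed points on each fixed line and 4 fixed lines through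
each fixed point (a pointwise fixed Baer-type subplane of order 3; 'beyond bound k' in the census). -/
def NoPlanarOrder3Order12 : Prop :=
  ∀ (P L : Type) [Membership P L] [Fintype P] [Fintype L] [ProjectivePlane P L],
    ProjectivePlane.order P L = 12 → ∀ σ : Collineation P L, σ.onPoints ^ 3 = 1 →
      ¬ (fixedCard σ.onPoints = 13 ∧ fixedCard σ.onLines = 13 ∧
          (∀ l : L, σ.onLines l = l → σ.fixedOnLine l = 4) ∧ (∀ p : P, σ.onPoints p = p → σ.fixedThrough p = 4))

/-- **Census statement, sub-cell 'flag type of order 3' (typed, NOT proved):** no projective plane of order 12 admits a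
collineation `σ ≠ 1` with `σ³ = 1` whose fixed points all lie on one fixed line `l` and whose fixed lines all pass through
one fixed point `c ∈ l`, with `1, 4, 7` or `10` fixed points and as many fixed lines ('beyond bound k' in the census). -/
def NoFlagOrder3Order12 : Prop :=
  ∀ (P L : Type) [Membership P L] [Fintype P] [Fintype L] [ProjectivePlane P L],
    ProjectivePlane.order P L = 12 → ∀ σ : Collineation P L, σ.onPoints ^ 3 = 1 → σ.onPoints ≠ 1 →
      ¬ (∃ (l : L) (c : P), σ.onLines l = l ∧ σ.onPoints c = c ∧ c ∈ l ∧
          (∀ p : P, σ.onPoints p = p → p ∈ l) ∧ (∀ m : L, σ.onLines m = m → c ∈ m) ∧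
          (fixedCard σ.onPoints = 1 ∨ fixedCard σ.onPoints = 4 ∨ fixedCard σ.onPoints = 7 ∨
            fixedCard σ.onPoints = 10) ∧
          (fixedCard σ.onLines = 1 ∨ fixedCard σ.onLines = 4 ∨ fixedCard σ.onLines = 7 ∨ fixedCard σ.onLines = 10))

/-- **The live cell `|G| = 3` is the union of its three sub-cells.** -/
theorem noOrderThree_of_subcells (hE : NoElationOrder3Order12) (hP : NoPlanarOrder3Order12) (hF : NoFlagOrder3Order12) :
    NoOrderThreeOrder12 := by
  intro P L _ _ _ _ h12 σ hq
  by_contra hne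
  rcases σ.order_three_structure h12 hne hq with ⟨l, c, hl, hc, hcl, -, -⟩ | hplanar | hflag
  · exact hne (hE P L h12 σ l c hl hc hcl hq)
  · exact hP P L h12 σ hq hplanar
  · exact hF P L h12 σ hq hne hflag

/-- The same with the elation sub-cell replaced by its finite array statement. -/
theorem noOrderThree_of_arrays (hE : NoLiftableSTD3_12_4) (hP : NoPlanarOrder3Order12) (hF : NoFlagOrder3Order12) :
    NoOrderThreeOrder12 :=
  noOrderThree_of_subcells (noElationOrder3_iff_noLiftableSTD3.2 hE) hP hF

/-- **Rigid endgame, v3.**  Janko–van Trung's `{2,3}`-group theorem (named fact), the finite array statements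
`NoLiftableSTD2_12_6` (involution cell) and `NoLiftableSTD3_12_4` (order-3 elation cell), and the census statements
`NoPlanarOrder3Order12`, `NoFlagOrder3Order12` force every collineation group of a projective plane of order 12 to be trivial. -/
theorem card_collineationGroup_eq_one_of_arrays (hJvT : CollineationGroupIsTwoThreeGroup)
    (h2 : NoLiftableSTD2_12_6) (h3E : NoLiftableSTD3_12_4) (h3P : NoPlanarOrder3Order12) (h3F : NoFlagOrder3Order12)
    (P L : Type) [Membership P L] [Fintype P] [Fintype L] [ProjectivePlane P L] (h12 : ProjectivePlane.order P L = 12)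
    (G : Type) [Group G] [Fintype G] [MulAction G P] [MulAction G L] (hG : IsCollineationGroup G P L) :
    Fintype.card G = 1 :=
  card_collineationGroup_eq_one_of_noLiftable hJvT h2 (noOrderThree_of_arrays h3E h3P h3F) P L h12 G hG

end Summit.Ventures.DiscreteObjects.PP12
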